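import Mathlib
import Literature.Analysis.FluidPDE.SuitableWeak
import HarnessLib

/-!
# Crux `EulerZoomLiouville.PowerGaugeEulerLiouville` (stmt-NavierStokesRegularity-19832), line `pressure-floor`:
# TOOLS FOR THE TWO KILLS (A3 `stub_deficitKill`, A4 `stub_excessKill`)

Route №10 `EulerZoomLiouville` (NavierStokesRegularity), crux E = Seregin's power-gauged ancient Euler class.  Line
`pressure-floor` (ideator ns-idea-11; `Cruxes/PowerGaugeEulerLiouville/Lines/pressure_floor.lean`).  This file holds the
pieces of slice-wise real analysis and arithmetic shared by the deficit kill (A3) and the excess kill (A4); no fluid mechanics.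

* `Kill.setLIntegral_tail_le` — THE DYADIC `A`-GAUGE TAIL: if `∫_{B(a)} g ≤ c a^γ` for all `a ≥ R` (`γ ≤ 1`, `R > 0`),
  then `∫_{|x| > R} g(x)/|x|³ dx ≤ 8 c R^{γ−3}` (shells `2^k R < |x| < 2^{k+2} R`, `lintegral_iUnion_le`, geometric sum
  `Σ 2^{−k}`); real-valued form `Kill.integrableOn_tail_and_le` for `g = |v|²`.
* `Kill.integrableOn_sq_ball`, `Kill.integral_sq_ball_le` — a slice with `∫⁻_{B(a)} ‖v‖ₑ² ≤ c a^γ` has `|v|²`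
  integrable on `B(a)` with `∫_{B(a)} |v|² ≤ c a^γ`.
* `Kill.ae_eq_zero_of_weighted_closedBall_le` — THE ENDGAME: if `∫_{B̄_n} w |v|² ≤ b_n` eventually with `b_n → 0` and
  `w > 0`, then `v = 0` a.e.
* `Kill.powerProfile_le_rpow_neg` — the layer bound `(1+|x|²)^{−β/2} ≤ R^{−β}` for `|x| ≥ R > 0`, `β ≥ 0`.
* `Kill.exists_beta_deficit`, `Kill.exists_beta_excess` — the exponent choices `β ∈ [0,1) ∩ (1−2ρ,1)` with
  `(1−β)/(3−β) > ε` (resp. `1/(3−β) < κ`), possible iff `ε < ρ/(1+ρ)` (resp. `κ > 1/(2+2ρ)`); verbatim the line file's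
  checked bookkeeping lemmas (the Cruxes file is not importable from `Theorems/`).

WHAT THIS IS NOT: not NS, not the crux — helper lemmas `--supports` stmt-19832 on the line `pressure-floor` (MODEL
lattice: 19832 is a crux CLASS of Euler-side strata, not NS regularity).  [folklore]
-/

noncomputable section

-- flat `Theorems/<Route><Decl>…` files of one crux share the namespace of the crux (tree convention)
set_option linter.dupNamespace false

open MeasureTheory Set Filter Topology Metric Function
open scoped ENNReal NNReal

namespace Summit.NavierStokesRegularity.NavierStokesRegularity.Theorems.PowerGaugeEulerLiouville.PressureFloor.Kill

/-! ### The dyadic tail of the `A`-gauge -/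

/-- The overlapping dyadic shells `2^k R < |x| < 2^{k+2} R` cover `{|x| > R}`. [folklore] -/
theorem compl_closedBall_subset_iUnion_shell {R : ℝ} (hR : 0 < R) :
    (closedBall (0 : EuclideanSpace ℝ (Fin 3)) R)ᶜ ⊆
      ⋃ k : ℕ, {x : EuclideanSpace ℝ (Fin 3) | 2 ^ k * R < ‖x‖ ∧ ‖x‖ < 2 ^ (k + 2) * R} := by
  intro x hx
  rw [mem_compl_iff, mem_closedBall, dist_zero_right, not_le] at hx
  have hex : ∃ k : ℕ, ‖x‖ < 2 ^ (k + 2) * R := by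
    obtain ⟨k, hk⟩ := pow_unbounded_of_one_lt (‖x‖ / R) (by norm_num : (1 : ℝ) < 2)
    refine ⟨k, ?_⟩
    rw [div_lt_iff₀ hR] at hk
    calc ‖x‖ < 2 ^ k * R := hk
      _ ≤ 2 ^ (k + 2) * R := by
          gcongr
          · norm_num
          · omega
  classical
  refine mem_iUnion.2 ⟨Nat.find hex, ?_, Nat.find_spec hex⟩
  rcases Nat.eq_zero_or_pos (Nat.find hex) with h0 | hpos
  · rw [h0, pow_zero, one_mul]; exact hx
  · have hmin := Nat.find_min hex (m := Nat.find hex - 1) (by omega)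
    rw [not_lt] at hmin
    have h2 : Nat.find hex - 1 + 2 = Nat.find hex + 1 := by omega
    rw [h2] at hmin
    calc (2 : ℝ) ^ Nat.find hex * R < 2 ^ (Nat.find hex + 1) * R := by
          gcongr
          · norm_num
          · omega
      _ ≤ ‖x‖ := hmin

/-- One dyadic shell of the tail: `∫_{2^kR<|x|<2^{k+2}R} g/|x|³ ≤ 4 c R^{γ−3} · 2^{−k}`. [folklore] -/
theorem setLIntegral_shell_le {g : EuclideanSpace ℝ (Fin 3) → ℝ≥0∞} {c γ R : ℝ} (hc : 0 ≤ c) (hγ1 : γ ≤ 1)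
    (hR : 0 < R)
    (hg : ∀ a : ℝ, R ≤ a → ∫⁻ x in ball (0 : EuclideanSpace ℝ (Fin 3)) a, g x ≤ ENNReal.ofReal (c * a ^ γ))
    (k : ℕ) :
    ∫⁻ x in {x : EuclideanSpace ℝ (Fin 3) | 2 ^ k * R < ‖x‖ ∧ ‖x‖ < 2 ^ (k + 2) * R},
        (ENNReal.ofReal (‖x‖ ^ 3))⁻¹ * g x ≤
      ENNReal.ofReal (4 * c * R ^ (γ - 3)) * (2⁻¹ : ℝ≥0∞) ^ k := by
  set S : Set (EuclideanSpace ℝ (Fin 3)) := {x | 2 ^ k * R < ‖x‖ ∧ ‖x‖ < 2 ^ (k + 2) * R} with hS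
  have hSmeas : MeasurableSet S :=
    (isOpen_lt (continuous_const) continuous_norm).inter (isOpen_lt continuous_norm continuous_const)
      |>.measurableSet
  have h2k : (0 : ℝ) < 2 ^ k * R := by positivity
  have hcube : (0 : ℝ) < (2 ^ k * R) ^ 3 := by positivity
  -- freeze |x|⁻³ on the shell
  have h1 : ∫⁻ x in S, (ENNReal.ofReal (‖x‖ ^ 3))⁻¹ * g x ≤
      ∫⁻ x in S, (ENNReal.ofReal ((2 ^ k * R) ^ 3))⁻¹ * g x := by
    refine setLIntegral_mono' hSmeas fun x hx => ?_
    gcongr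
    exact hx.1.le
  have hne : (ENNReal.ofReal ((2 ^ k * R) ^ 3))⁻¹ ≠ ⊤ := by
    rw [ne_eq, ENNReal.inv_eq_top, ENNReal.ofReal_eq_zero, not_le]; exact hcube
  rw [lintegral_const_mul' _ _ hne] at h1
  -- the ball bound at radius 2^{k+2} R
  have hSball : S ⊆ ball (0 : EuclideanSpace ℝ (Fin 3)) (2 ^ (k + 2) * R) := fun x hx => by
    rw [mem_ball, dist_zero_right]; exact hx.2
  have hRa : R ≤ 2 ^ (k + 2) * R := le_mul_of_one_le_left hR.le (one_le_pow₀ (by norm_num))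
  have h2 : ∫⁻ x in S, g x ≤ ENNReal.ofReal (c * (2 ^ (k + 2) * R) ^ γ) :=
    le_trans (lintegral_mono_set hSball) (hg _ hRa)
  -- arithmetic in `ℝ`
  have hpowγ : ((2 : ℝ) ^ (k + 2)) ^ γ ≤ (2 : ℝ) ^ (k + 2) := by
    conv_rhs => rw [← Real.rpow_one ((2 : ℝ) ^ (k + 2))]
    exact Real.rpow_le_rpow_of_exponent_le (one_le_pow₀ (by norm_num)) hγ1
  have hRγ : 0 ≤ R ^ γ := Real.rpow_nonneg hR.le _
  have hsplit : (2 ^ (k + 2) * R) ^ γ = ((2 : ℝ) ^ (k + 2)) ^ γ * R ^ γ :=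
    Real.mul_rpow (by positivity) hR.le
  have hR3 : R ^ (γ - 3) = R ^ γ / R ^ 3 := by
    rw [Real.rpow_sub hR]
    congr 1
    exact_mod_cast Real.rpow_natCast R 3
  have hR3pos : (0 : ℝ) < R ^ 3 := by positivity
  have ht1 : (1 : ℝ) ≤ 2 ^ k := one_le_pow₀ (by norm_num)
  have ht0 : (0 : ℝ) < 2 ^ k := by positivity
  have h42 : (2 : ℝ) ^ (k + 2) = 4 * 2 ^ k := by rw [pow_add]; norm_num; ring
  have hreal : ((2 ^ k * R) ^ 3)⁻¹ * (c * (2 ^ (k + 2) * R) ^ γ) ≤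
      4 * c * R ^ (γ - 3) * ((2 : ℝ) ^ k)⁻¹ := by
    calc (((2 : ℝ) ^ k * R) ^ 3)⁻¹ * (c * (2 ^ (k + 2) * R) ^ γ)
          ≤ ((2 ^ k * R) ^ 3)⁻¹ * (c * (2 ^ (k + 2) * R ^ γ)) := by
            rw [hsplit]
            gcongr
      _ = 4 * c * R ^ (γ - 3) * ((2 : ℝ) ^ k)⁻¹ * ((2 : ℝ) ^ k)⁻¹ := by
            rw [hR3, h42]
            field_simp
      _ ≤ 4 * c * R ^ (γ - 3) * ((2 : ℝ) ^ k)⁻¹ :=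
            mul_le_of_le_one_right (by positivity) (inv_le_one_of_one_le₀ ht1)
  calc ∫⁻ x in S, (ENNReal.ofReal (‖x‖ ^ 3))⁻¹ * g x
        ≤ (ENNReal.ofReal ((2 ^ k * R) ^ 3))⁻¹ * ∫⁻ x in S, g x := h1
    _ ≤ (ENNReal.ofReal ((2 ^ k * R) ^ 3))⁻¹ * ENNReal.ofReal (c * (2 ^ (k + 2) * R) ^ γ) := by gcongr
    _ = ENNReal.ofReal (((2 ^ k * R) ^ 3)⁻¹ * (c * (2 ^ (k + 2) * R) ^ γ)) := by
          rw [← ENNReal.ofReal_inv_of_pos hcube, ← ENNReal.ofReal_mul (inv_nonneg.2 hcube.le)]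
    _ ≤ ENNReal.ofReal (4 * c * R ^ (γ - 3) * ((2 : ℝ) ^ k)⁻¹) := ENNReal.ofReal_le_ofReal hreal
    _ = ENNReal.ofReal (4 * c * R ^ (γ - 3)) * (2⁻¹ : ℝ≥0∞) ^ k := by
          rw [ENNReal.ofReal_mul (by positivity), ENNReal.ofReal_inv_of_pos ht0,
            ENNReal.ofReal_pow (by norm_num), ENNReal.ofReal_ofNat, ENNReal.inv_pow]

/-- **The dyadic `A`-gauge tail.**  If a non-negative density `g` on `ℝ³` has `∫_{B(a)} g ≤ c a^γ` for every `a ≥ R`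
(`γ ≤ 1`, `R > 0`, `c ≥ 0`), then `∫_{|x|>R} g(x) |x|^{−3} dx ≤ 8 c R^{γ−3}`: cover `{|x| > R}` by the shells
`2^k R < |x| < 2^{k+2} R`, on which `|x|^{−3} ≤ (2^k R)^{−3}` and `∫ g ≤ c (2^{k+2}R)^γ ≤ 4 c 2^k R^γ`, and sum the
geometric series. (The velocity tail of a member of Seregin's class against a tidal `|x|^{−3}` weight.) [folklore] -/
theorem setLIntegral_tail_le {g : EuclideanSpace ℝ (Fin 3) → ℝ≥0∞} {c γ R : ℝ} (hc : 0 ≤ c) (hγ1 : γ ≤ 1)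
    (hR : 0 < R)
    (hg : ∀ a : ℝ, R ≤ a → ∫⁻ x in ball (0 : EuclideanSpace ℝ (Fin 3)) a, g x ≤ ENNReal.ofReal (c * a ^ γ)) :
    ∫⁻ x in (closedBall (0 : EuclideanSpace ℝ (Fin 3)) R)ᶜ, (ENNReal.ofReal (‖x‖ ^ 3))⁻¹ * g x ≤
      ENNReal.ofReal (8 * c * R ^ (γ - 3)) := by
  calc ∫⁻ x in (closedBall (0 : EuclideanSpace ℝ (Fin 3)) R)ᶜ, (ENNReal.ofReal (‖x‖ ^ 3))⁻¹ * g x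
        ≤ ∫⁻ x in ⋃ k : ℕ, {x : EuclideanSpace ℝ (Fin 3) | 2 ^ k * R < ‖x‖ ∧ ‖x‖ < 2 ^ (k + 2) * R},
            (ENNReal.ofReal (‖x‖ ^ 3))⁻¹ * g x := lintegral_mono_set (compl_closedBall_subset_iUnion_shell hR)
    _ ≤ ∑' k : ℕ, ∫⁻ x in {x : EuclideanSpace ℝ (Fin 3) | 2 ^ k * R < ‖x‖ ∧ ‖x‖ < 2 ^ (k + 2) * R},
            (ENNReal.ofReal (‖x‖ ^ 3))⁻¹ * g x := lintegral_iUnion_le _ _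
    _ ≤ ∑' k : ℕ, ENNReal.ofReal (4 * c * R ^ (γ - 3)) * (2⁻¹ : ℝ≥0∞) ^ k :=
          ENNReal.tsum_le_tsum (setLIntegral_shell_le hc hγ1 hR hg)
    _ = ENNReal.ofReal (4 * c * R ^ (γ - 3)) * 2 := by
          rw [ENNReal.tsum_mul_left, ENNReal.tsum_geometric_two]
    _ = ENNReal.ofReal (8 * c * R ^ (γ - 3)) := by
          rw [← ENNReal.ofReal_ofNat 2, ← ENNReal.ofReal_mul (by positivity)]
          congr 1; ring

/-- **Real-valued tail bound for a slice.**  For an a.e.-strongly measurable field `v` with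
`∫⁻_{B(a)} ‖v‖ₑ² ≤ c a^γ` for all `a ≥ R` (`γ ≤ 1`, `R > 0`, `c ≥ 0`), the tidal density `|v(x)|²/|x|³` is integrable
on `{|x| > R}` with `∫_{|x|>R} |v|²/|x|³ ≤ 8 c R^{γ−3}`. [folklore] -/
theorem integrableOn_tail_and_le {v : EuclideanSpace ℝ (Fin 3) → EuclideanSpace ℝ (Fin 3)}
    (hv : AEStronglyMeasurable v volume) {c γ R : ℝ} (hc : 0 ≤ c) (hγ1 : γ ≤ 1) (hR : 0 < R)
    (hg : ∀ a : ℝ, R ≤ a →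
      ∫⁻ x in ball (0 : EuclideanSpace ℝ (Fin 3)) a, ‖v x‖ₑ ^ 2 ≤ ENNReal.ofReal (c * a ^ γ)) :
    IntegrableOn (fun x => ‖v x‖ ^ 2 / ‖x‖ ^ 3) (closedBall (0 : EuclideanSpace ℝ (Fin 3)) R)ᶜ volume ∧
      ∫ x in (closedBall (0 : EuclideanSpace ℝ (Fin 3)) R)ᶜ, ‖v x‖ ^ 2 / ‖x‖ ^ 3 ≤ 8 * c * R ^ (γ - 3) := by
  set B : Set (EuclideanSpace ℝ (Fin 3)) := closedBall 0 R with hB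
  have hBm : MeasurableSet Bᶜ := measurableSet_closedBall.compl
  have htail := setLIntegral_tail_le hc hγ1 hR hg
  -- the lintegral of the real density on `Bᶜ` is the dyadic tail
  have hmeas : AEStronglyMeasurable (fun x : EuclideanSpace ℝ (Fin 3) => ‖v x‖ ^ 2 / ‖x‖ ^ 3)
      (volume.restrict Bᶜ) := by
    have h1 : AEStronglyMeasurable (fun x : EuclideanSpace ℝ (Fin 3) => ‖v x‖ ^ 2) volume := hv.norm.pow 2
    have h2 : AEStronglyMeasurable (fun x : EuclideanSpace ℝ (Fin 3) => (‖x‖ ^ 3)⁻¹) volume :=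
      (continuous_norm.pow 3).measurable.inv.aestronglyMeasurable
    exact ((h1.mul h2).congr (Eventually.of_forall fun x => by simp [div_eq_mul_inv])).restrict
  have hnonneg : 0 ≤ᵐ[volume.restrict Bᶜ] fun x : EuclideanSpace ℝ (Fin 3) => ‖v x‖ ^ 2 / ‖x‖ ^ 3 :=
    Eventually.of_forall fun x => by positivity
  have hlin : ∫⁻ x in Bᶜ, ENNReal.ofReal (‖v x‖ ^ 2 / ‖x‖ ^ 3) =
      ∫⁻ x in Bᶜ, (ENNReal.ofReal (‖x‖ ^ 3))⁻¹ * ‖v x‖ₑ ^ 2 := by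
    refine setLIntegral_congr_fun hBm fun x hx => ?_
    have hx' : R < ‖x‖ := by
      rw [mem_compl_iff, mem_closedBall, dist_zero_right, not_le] at hx; exact hx
    have hx3 : (0 : ℝ) < ‖x‖ ^ 3 := pow_pos (lt_trans hR hx') 3
    rw [ENNReal.ofReal_div_of_pos hx3, div_eq_mul_inv, mul_comm, ENNReal.ofReal_pow (norm_nonneg (v x)),
      ofReal_norm]
  have hfin : ∫⁻ x in Bᶜ, ENNReal.ofReal (‖v x‖ ^ 2 / ‖x‖ ^ 3) < ⊤ := by
    rw [hlin]; exact lt_of_le_of_lt htail ENNReal.ofReal_lt_top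
  have hint : IntegrableOn (fun x => ‖v x‖ ^ 2 / ‖x‖ ^ 3) Bᶜ volume := by
    refine ⟨hmeas, ?_⟩
    rw [hasFiniteIntegral_iff_enorm]
    refine lt_of_le_of_lt (le_of_eq (lintegral_congr_ae ?_)) hfin
    filter_upwards [hnonneg] with x hx
    rw [Real.enorm_eq_ofReal hx]
  refine ⟨hint, ?_⟩
  rw [integral_eq_lintegral_of_nonneg_ae hnonneg hmeas, hlin]
  have h8 : 0 ≤ 8 * c * R ^ (γ - 3) := by positivity
  calc (∫⁻ x in Bᶜ, (ENNReal.ofReal (‖x‖ ^ 3))⁻¹ * ‖v x‖ₑ ^ 2).toReal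
        ≤ (ENNReal.ofReal (8 * c * R ^ (γ - 3))).toReal :=
          ENNReal.toReal_mono ENNReal.ofReal_ne_top htail
    _ = 8 * c * R ^ (γ - 3) := ENNReal.toReal_ofReal h8

/-! ### Slices with finite local energy -/

/-- A slice with `∫⁻_{B(a)} ‖v‖ₑ² < ∞` has `|v|²` integrable on `B(a)`. [folklore] -/
theorem integrableOn_sq_ball {v : EuclideanSpace ℝ (Fin 3) → EuclideanSpace ℝ (Fin 3)}
    (hv : AEStronglyMeasurable v volume) {a : ℝ}
    (hfin : ∫⁻ x in ball (0 : EuclideanSpace ℝ (Fin 3)) a, ‖v x‖ₑ ^ 2 < ⊤) :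
    IntegrableOn (fun x => ‖v x‖ ^ 2) (ball (0 : EuclideanSpace ℝ (Fin 3)) a) volume := by
  refine ⟨(hv.norm.pow 2).restrict, ?_⟩
  rw [hasFiniteIntegral_iff_enorm]
  refine lt_of_le_of_lt (lintegral_mono fun x => le_of_eq ?_) hfin
  rw [Real.enorm_eq_ofReal (by positivity), ← ofReal_norm, ENNReal.ofReal_pow (norm_nonneg _)]

/-- A slice with `∫⁻_{B(a)} ‖v‖ₑ² ≤ c a^γ` has `∫_{B(a)} |v|² ≤ c a^γ` (`c a^γ ≥ 0`). [folklore] -/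
theorem integral_sq_ball_le {v : EuclideanSpace ℝ (Fin 3) → EuclideanSpace ℝ (Fin 3)}
    (hv : AEStronglyMeasurable v volume) {a c γ : ℝ} (hca : 0 ≤ c * a ^ γ)
    (hle : ∫⁻ x in ball (0 : EuclideanSpace ℝ (Fin 3)) a, ‖v x‖ₑ ^ 2 ≤ ENNReal.ofReal (c * a ^ γ)) :
    ∫ x in ball (0 : EuclideanSpace ℝ (Fin 3)) a, ‖v x‖ ^ 2 ≤ c * a ^ γ := by
  have hm : AEStronglyMeasurable (fun x => ‖v x‖ ^ 2)
      (volume.restrict (ball (0 : EuclideanSpace ℝ (Fin 3)) a)) := (hv.norm.pow 2).restrict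
  rw [integral_eq_lintegral_of_nonneg_ae (Eventually.of_forall fun x => by positivity) hm]
  have hlin : ∫⁻ x in ball (0 : EuclideanSpace ℝ (Fin 3)) a, ENNReal.ofReal (‖v x‖ ^ 2) =
      ∫⁻ x in ball (0 : EuclideanSpace ℝ (Fin 3)) a, ‖v x‖ₑ ^ 2 :=
    lintegral_congr fun x => by rw [← ofReal_norm, ENNReal.ofReal_pow (norm_nonneg _)]
  rw [hlin]
  calc (∫⁻ x in ball (0 : EuclideanSpace ℝ (Fin 3)) a, ‖v x‖ₑ ^ 2).toReal
        ≤ (ENNReal.ofReal (c * a ^ γ)).toReal := ENNReal.toReal_mono ENNReal.ofReal_ne_top hle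
    _ = c * a ^ γ := ENNReal.toReal_ofReal hca

/-- A weight bounded by `1` in absolute value keeps `|v|²` integrable on a set. [folklore] -/
theorem integrableOn_weight_mul_sq {v : EuclideanSpace ℝ (Fin 3) → EuclideanSpace ℝ (Fin 3)}
    {s : Set (EuclideanSpace ℝ (Fin 3))} (hvs : IntegrableOn (fun x => ‖v x‖ ^ 2) s volume)
    {w : EuclideanSpace ℝ (Fin 3) → ℝ} (hwm : AEStronglyMeasurable w volume) (hw1 : ∀ x, |w x| ≤ 1) :
    IntegrableOn (fun x => w x * ‖v x‖ ^ 2) s volume :=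
  Integrable.bdd_mul hvs hwm.restrict (Eventually.of_forall fun x => by
    rw [Real.norm_eq_abs]; exact hw1 x)

/-! ### The endgame: weighted energies on large balls tending to zero -/

/-- **Endgame.**  If `w > 0`, `w |v|²` is integrable on every closed ball `B̄_n`, and
`∫_{B̄_n} w |v|² ≤ b_n` for all large `n` with `b_n → 0`, then `v = 0` a.e.: for fixed `N ≤ n`,
`0 ≤ ∫_{B̄_N} w|v|² ≤ ∫_{B̄_n} w|v|² ≤ b_n → 0`. [folklore] -/
theorem ae_eq_zero_of_weighted_closedBall_le {v : EuclideanSpace ℝ (Fin 3) → EuclideanSpace ℝ (Fin 3)}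
    {w : EuclideanSpace ℝ (Fin 3) → ℝ} (hw : ∀ x, 0 < w x)
    (hint : ∀ n : ℕ, IntegrableOn (fun x => w x * ‖v x‖ ^ 2) (closedBall (0 : EuclideanSpace ℝ (Fin 3)) n) volume)
    {b : ℕ → ℝ} (hb : Tendsto b atTop (𝓝 0))
    (hle : ∀ᶠ n : ℕ in atTop, ∫ x in closedBall (0 : EuclideanSpace ℝ (Fin 3)) n, w x * ‖v x‖ ^ 2 ≤ b n) :
    v =ᵐ[volume] 0 := by
  have hnn : ∀ x, 0 ≤ w x * ‖v x‖ ^ 2 := fun x => mul_nonneg (hw x).le (sq_nonneg _)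
  -- every closed ball carries zero weighted energy
  have hball : ∀ N : ℕ, ∫ x in closedBall (0 : EuclideanSpace ℝ (Fin 3)) N, w x * ‖v x‖ ^ 2 = 0 := by
    intro N
    refine le_antisymm ?_ (setIntegral_nonneg measurableSet_closedBall fun x _ => hnn x)
    refine ge_of_tendsto hb ?_
    filter_upwards [hle, eventually_ge_atTop N] with n hn hNn
    refine le_trans (setIntegral_mono_set (hint n) (Eventually.of_forall fun x => hnn x)
      (Eventually.of_forall <| closedBall_subset_closedBall (by exact_mod_cast hNn))) hn
  -- hence `v = 0` a.e. on every closed ball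
  have hballae : ∀ N : ℕ, ∀ᵐ x ∂(volume.restrict (closedBall (0 : EuclideanSpace ℝ (Fin 3)) N)), v x = 0 := by
    intro N
    have h0 := (setIntegral_eq_zero_iff_of_nonneg_ae (Eventually.of_forall fun x => hnn x) (hint N)).1
      (hball N)
    filter_upwards [h0] with x hx
    have hx' : w x * ‖v x‖ ^ 2 = 0 := hx
    rcases mul_eq_zero.1 hx' with h | h
    · exact absurd h (hw x).ne'
    · exact norm_eq_zero.1 (pow_eq_zero_iff (n := 2) two_ne_zero |>.1 h)
  have hU : ∀ᵐ x ∂(volume.restrict (⋃ N : ℕ, closedBall (0 : EuclideanSpace ℝ (Fin 3)) N)), v x = 0 :=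
    (ae_restrict_iUnion_iff _ _).2 hballae
  rw [iUnion_closedBall_nat, Measure.restrict_univ] at hU
  exact hU

/-! ### The power profile on the layer -/

/-- `0 < (1+|x|²)^{−β/2} ≤ 1` for `β ≥ 0`. [folklore] -/
theorem powerProfile_pos_le_one {β : ℝ} (hβ : 0 ≤ β) (x : EuclideanSpace ℝ (Fin 3)) :
    0 < (1 + ‖x‖ ^ 2) ^ (-(β / 2)) ∧ (1 + ‖x‖ ^ 2) ^ (-(β / 2)) ≤ 1 := by
  have h1 : (1 : ℝ) ≤ 1 + ‖x‖ ^ 2 := by nlinarith [norm_nonneg x]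
  exact ⟨Real.rpow_pos_of_pos (by positivity) _,
    Real.rpow_le_one_of_one_le_of_nonpos h1 (by linarith)⟩

/-- The profile is continuous. [folklore] -/
theorem continuous_powerProfile (β : ℝ) :
    Continuous fun x : EuclideanSpace ℝ (Fin 3) => (1 + ‖x‖ ^ 2) ^ (-(β / 2)) :=
  Continuous.rpow_const (continuous_const.add (continuous_norm.pow 2))
    fun x => Or.inl (by positivity)

/-- **Layer bound**: `(1+|x|²)^{−β/2} ≤ R^{−β}` for `|x| ≥ R > 0`, `β ≥ 0`. [folklore] -/
theorem powerProfile_le_rpow_neg {β R : ℝ} (hβ : 0 ≤ β) (hR : 0 < R) {x : EuclideanSpace ℝ (Fin 3)}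
    (hx : R ≤ ‖x‖) : (1 + ‖x‖ ^ 2) ^ (-(β / 2)) ≤ R ^ (-β) := by
  have hR2 : (0 : ℝ) < R ^ 2 := by positivity
  have hle : R ^ 2 ≤ 1 + ‖x‖ ^ 2 := by nlinarith [norm_nonneg x]
  calc (1 + ‖x‖ ^ 2) ^ (-(β / 2)) ≤ (R ^ 2) ^ (-(β / 2)) :=
        Real.rpow_le_rpow_of_nonpos hR2 hle (by linarith)
    _ = R ^ (-β) := by
        rw [← Real.rpow_natCast R 2, ← Real.rpow_mul hR.le]
        congr 1; push_cast; ring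

/-! ### The two exponent choices (verbatim from the line file, kernel-checked there) -/

/-- **The deficit exponent choice**: for `ε < ρ/(1+ρ)`, `0 < ρ ≤ 1/2`, an admissible `β ∈ [0,1) ∩ (1−2ρ,1)` with
interior pinching constant `(1−β)/(3−β) > ε` exists (`β = (1−3m)/(1−m)` with `m` the midpoint of `ε` and `ρ/(1+ρ)`
makes `(1−β)/(3−β) = m`).  Verbatim the checked lemma `exists_beta_deficit` of the line file. [folklore] -/
theorem exists_beta_deficit {ρ ε : ℝ} (hρ : 0 < ρ) (hρ2 : ρ ≤ 1 / 2) (hε : ε < ρ / (1 + ρ)) :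
    ∃ β : ℝ, 0 ≤ β ∧ β < 1 ∧ 1 - 2 * ρ < β ∧ ε < (1 - β) / (3 - β) := by
  have hq : 0 < ρ / (1 + ρ) := by positivity
  have hq3 : ρ / (1 + ρ) ≤ 1 / 3 := by
    rw [div_le_div_iff₀ (by linarith) (by norm_num)]
    linarith
  by_cases hε0 : ε ≤ 0
  · refine ⟨1 - ρ, by linarith, by linarith, by linarith, ?_⟩
    have : (0 : ℝ) < (1 - (1 - ρ)) / (3 - (1 - ρ)) := div_pos (by linarith) (by linarith)
    linarith
  · rw [not_le] at hε0
    set m : ℝ := (ε + ρ / (1 + ρ)) / 2 with hm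
    have hmε : ε < m := by rw [hm]; linarith
    have hmq : m < ρ / (1 + ρ) := by rw [hm]; linarith
    have hm0 : 0 < m := by linarith
    have hm3 : m < 1 / 3 := by linarith
    have h1m : 0 < 1 - m := by linarith
    refine ⟨(1 - 3 * m) / (1 - m), div_nonneg (by linarith) h1m.le, ?_, ?_, ?_⟩
    · rw [div_lt_one h1m]
      linarith
    · rw [lt_div_iff₀ h1m]
      have h' : m * (1 + ρ) < ρ := by
        have := hmq
        rwa [lt_div_iff₀ (by linarith)] at this
      nlinarith
    · have hβ1 : 1 - (1 - 3 * m) / (1 - m) = 2 * m / (1 - m) := by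
        field_simp
        ring
      have hβ3 : 3 - (1 - 3 * m) / (1 - m) = 2 / (1 - m) := by
        field_simp
        ring
      rw [hβ1, hβ3, div_div_div_cancel_right₀ (ne_of_gt h1m)]
      linarith

/-- **The excess exponent choice**: for `κ > 1/(2+2ρ)`, `0 < ρ ≤ 1/2`, an admissible `β ∈ [0,1) ∩ (1−2ρ,1)` with
upper pinching constant `1/(3−β) < κ` exists (`β = 3 − 1/m` with `m` the midpoint of `1/(2+2ρ)` and `min κ ½` makes
`1/(3−β) = m`).  Verbatim the checked lemma `exists_beta_excess` of the line file. [folklore] -/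
theorem exists_beta_excess {ρ κ : ℝ} (hρ : 0 < ρ) (hρ2 : ρ ≤ 1 / 2) (hκ : 1 / (2 + 2 * ρ) < κ) :
    ∃ β : ℝ, 0 ≤ β ∧ β < 1 ∧ 1 - 2 * ρ < β ∧ 1 / (3 - β) < κ := by
  have hq : (0 : ℝ) < 1 / (2 + 2 * ρ) := by positivity
  have hq3 : (1 : ℝ) / 3 ≤ 1 / (2 + 2 * ρ) := by
    rw [div_le_div_iff₀ (by norm_num) (by linarith)]
    linarith
  set κ' : ℝ := min κ (1 / 2) with hκ'
  have hκ'κ : κ' ≤ κ := min_le_left _ _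
  have hκ'h : κ' ≤ 1 / 2 := min_le_right _ _
  have hqκ' : 1 / (2 + 2 * ρ) < κ' := by
    rw [hκ']
    refine lt_min hκ ?_
    rw [div_lt_div_iff₀ (by linarith) (by norm_num)]
    linarith
  set m : ℝ := (1 / (2 + 2 * ρ) + κ') / 2 with hm
  have hmq : 1 / (2 + 2 * ρ) < m := by rw [hm]; linarith
  have hmκ : m < κ' := by rw [hm]; linarith
  have hm0 : 0 < m := by linarith
  have hm3 : 1 / 3 < m := by linarith
  have hmh : m < 1 / 2 := by linarith
  refine ⟨3 - 1 / m, ?_, ?_, ?_, ?_⟩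
  · have : 1 / m ≤ 3 := by
      rw [div_le_iff₀ hm0]
      linarith
    linarith
  · have : 2 < 1 / m := by
      rw [lt_div_iff₀ hm0]
      linarith
    linarith
  · have h' : 1 < m * (2 + 2 * ρ) := by
      have := hmq
      rwa [div_lt_iff₀ (by linarith)] at this
    have : 1 / m < 2 + 2 * ρ := by
      rw [div_lt_iff₀ hm0]
      linarith
    linarith
  · have : 3 - (3 - 1 / m) = 1 / m := by ring
    rw [this, one_div_one_div]
    linarith

end Summit.NavierStokesRegularity.NavierStokesRegularity.Theorems.PowerGaugeEulerLiouville.PressureFloor.Kill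

end
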